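import Literature.RepresentationTheory.Semisimple.BrauerNesbitt
import Literature.RepresentationTheory.Semisimple.Semisimplification
import Literature.RepresentationTheory.Semisimple.SubrepresentationEquiv
import Mathlib.LinearAlgebra.Matrix.ToLin
import Mathlib.LinearAlgebra.Matrix.GeneralLinearGroup.Defs
import Mathlib.LinearAlgebra.Charpoly.ToMatrix
import Mathlib.RepresentationTheory.Irreducible
import HarnessLib

/-!
# Route `PhantomRMYoshida`, crux `ResiduallyYoshidaLifting` (stmt-Langlands-13639), line
# `endoscopic-crossing-euler`: stub 2c — block sums of irreducibles with equal characteristic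
# polynomials are conjugate (Brauer–Nesbitt assembly)

The registered stub `stub_blockSumConj` of the checked skeleton
`Cruxes/ResiduallyYoshidaLifting/Lines/endoscopic-crossing-euler.lean`: for a field `k` (any
characteristic), a group `Γ` and homomorphisms `a, d, σ, σ' : Γ → GL₂(k)` that are irreducible on
`k²` with `det(X - a g) · det(X - d g) = det(X - σ g) · det(X - σ' g)` for all `g`, the block sums
`a ⊕ d` and `σ ⊕ σ'` (block diagonal along `finSumFinEquiv : Fin 2 ⊕ Fin 2 ≃ Fin 4`) are conjugate
by some `h ∈ GL₄(k)`.

Proof: both block sums are homomorphisms `ψ₁, ψ₂ : Γ → GL₄(k)`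
(`Literature.RepresentationTheory.Semisimple.exists_blockDiag_hom`) whose representations on `k⁴`
are semisimple (`isSemisimpleRepresentation_of_blockDiag`; irreducible ⇒ semisimple, Mathlib's
instance `IsSimpleOrder → ComplementedLattice`) with equal characteristic polynomials
(`Matrix.charpoly_reindex`, `Matrix.charpoly_fromBlocks_zero₂₁`), so the Brauer–Nesbitt theorem over
an arbitrary field (`Representation.nonempty_equiv_of_charpoly_eq`, Bourbaki A VIII § 20 n° 6 Thm 2
Cor 1) gives an equivalence of representations `E : k⁴ ≃ k⁴`, `E ∘ ψ₁(g) = ψ₂(g) ∘ E`; its matrix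
`H` satisfies `H · ψ₁(g) = ψ₂(g) · H`, i.e. `ψ₁(g) = H⁻¹ ψ₂(g) H`, and `h := H⁻¹`.

References: N. Bourbaki, *Algèbre* VIII (2012), § 20 n° 6, Thm 2, Cor 1 [BourbakiAlgebreVIII2012].
-/

noncomputable section

-- `Summit.Langlands.Langlands.…` (summit = sub-problem name, D-0017 layout) trips `dupNamespace` on every decl;
-- project-wide option (lakefile `weak.linter.dupNamespace = false`).
set_option linter.dupNamespace false
set_option autoImplicit false

open scoped MatrixGroups

namespace Summit.Langlands.Langlands.Cruxes.ResiduallyYoshidaLifting.EndoscopicCrossingEuler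

open Literature.RepresentationTheory.Semisimple

/-- The characteristic polynomial of `g` in the representation of `Γ` on `kⁿ` through
`ψ : Γ → GL_n(k)` (Mathlib `Representation.ofDistribMulAction`, i.e. `v ↦ ψ(g) *ᵥ v`) is the
characteristic polynomial of the matrix `ψ(g)`. [folklore] -/
private theorem charpoly_rep_eq {k : Type} [Field k] {Γ : Type} [Group Γ] {n : ℕ}
    (ψ : Γ →* GL (Fin n) k) (g : Γ) :
    (((Representation.ofDistribMulAction k (GL (Fin n) k) (Fin n → k)).comp ψ) g).charpoly =
      ((ψ g : GL (Fin n) k) : Matrix (Fin n) (Fin n) k).charpoly := by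
  have hRlin : (((Representation.ofDistribMulAction k (GL (Fin n) k) (Fin n → k)).comp ψ) g :
        (Fin n → k) →ₗ[k] (Fin n → k)) =
      Matrix.toLin' ((ψ g : GL (Fin n) k) : Matrix (Fin n) (Fin n) k) :=
    LinearMap.ext fun v ↦ by rw [Matrix.toLin'_apply]; rfl
  rw [hRlin, Matrix.charpoly_toLin']

/-- The representation on `kⁿ` through `ψ : Γ → GL_n(k)`, as a linear map, is `Matrix.toLin'` of
the matrix `ψ(g)`; hence its matrix in the standard basis is `ψ(g)`. [folklore] -/
private theorem toMatrix'_rep_eq {k : Type} [Field k] {Γ : Type} [Group Γ] {n : ℕ}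
    (ψ : Γ →* GL (Fin n) k) (g : Γ) :
    LinearMap.toMatrix' (((Representation.ofDistribMulAction k (GL (Fin n) k) (Fin n → k)).comp ψ) g :
        (Fin n → k) →ₗ[k] (Fin n → k)) =
      ((ψ g : GL (Fin n) k) : Matrix (Fin n) (Fin n) k) := by
  have hRlin : (((Representation.ofDistribMulAction k (GL (Fin n) k) (Fin n → k)).comp ψ) g :
        (Fin n → k) →ₗ[k] (Fin n → k)) =
      Matrix.toLin' ((ψ g : GL (Fin n) k) : Matrix (Fin n) (Fin n) k) :=
    LinearMap.ext fun v ↦ by rw [Matrix.toLin'_apply]; rfl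
  rw [hRlin, LinearMap.toMatrix'_toLin']

/-- An irreducible representation is semisimple (a simple bounded lattice is complemented).
[folklore] -/
private theorem isSemisimple_of_isIrreducible {k : Type} [Field k] {Γ : Type} [Group Γ]
    {V : Type} [AddCommGroup V] [Module k V] (ρ : Representation k Γ V)
    (h : ρ.IsIrreducible) : ρ.IsSemisimpleRepresentation := by
  haveI : IsSimpleOrder (Subrepresentation ρ) := h
  exact (inferInstance : ComplementedLattice (Subrepresentation ρ))

/-- **Conjugacy of semisimple matrix representations with equal characteristic polynomials**
(Brauer–Nesbitt in matrix form): if `ψ₁, ψ₂ : Γ → GL_n(k)` have semisimple representations on `kⁿ`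
and `det(X - ψ₁ g) = det(X - ψ₂ g)` for all `g`, then `ψ₁ = h ψ₂ h⁻¹` for some `h ∈ GL_n(k)`.
[cite: BourbakiAlgebreVIII2012, VIII § 20 n° 6, Thm. 2, Cor. 1 (p. 378)] -/
private theorem exists_conj_of_charpoly_eq {k : Type} [Field k] {Γ : Type} [Group Γ] {n : ℕ}
    (ψ₁ ψ₂ : Γ →* GL (Fin n) k)
    (h₁ : Representation.IsSemisimpleRepresentation
      ((Representation.ofDistribMulAction k (GL (Fin n) k) (Fin n → k)).comp ψ₁))
    (h₂ : Representation.IsSemisimpleRepresentation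
      ((Representation.ofDistribMulAction k (GL (Fin n) k) (Fin n → k)).comp ψ₂))
    (hcp : ∀ g, ((ψ₁ g : GL (Fin n) k) : Matrix (Fin n) (Fin n) k).charpoly =
      ((ψ₂ g : GL (Fin n) k) : Matrix (Fin n) (Fin n) k).charpoly) :
    ∃ h : GL (Fin n) k, ∀ g,
      ((ψ₁ g : GL (Fin n) k) : Matrix (Fin n) (Fin n) k) =
        (h : Matrix (Fin n) (Fin n) k) * ((ψ₂ g : GL (Fin n) k) : Matrix (Fin n) (Fin n) k) *
          ((h⁻¹ : GL (Fin n) k) : Matrix (Fin n) (Fin n) k) := by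
  set ρ₁ : Representation k Γ (Fin n → k) :=
    (Representation.ofDistribMulAction k (GL (Fin n) k) (Fin n → k)).comp ψ₁ with hρ₁
  set ρ₂ : Representation k Γ (Fin n → k) :=
    (Representation.ofDistribMulAction k (GL (Fin n) k) (Fin n → k)).comp ψ₂ with hρ₂
  haveI : ρ₁.IsSemisimpleRepresentation := h₁
  haveI : ρ₂.IsSemisimpleRepresentation := h₂
  have hcp' : ∀ g, (ρ₁ g).charpoly = (ρ₂ g).charpoly := fun g ↦ by
    rw [hρ₁, hρ₂, charpoly_rep_eq, charpoly_rep_eq, hcp g]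
  obtain ⟨e⟩ := Representation.nonempty_equiv_of_charpoly_eq ρ₁ ρ₂ hcp'
  -- the matrix `H` of `e` and the matrix `H'` of `e⁻¹`
  set E : (Fin n → k) ≃ₗ[k] (Fin n → k) := e.toLinearEquiv with hE
  set H : Matrix (Fin n) (Fin n) k := LinearMap.toMatrix' (E : (Fin n → k) →ₗ[k] (Fin n → k))
    with hH
  set H' : Matrix (Fin n) (Fin n) k :=
    LinearMap.toMatrix' (E.symm : (Fin n → k) →ₗ[k] (Fin n → k)) with hH'
  have hHH' : H * H' = 1 := by
    rw [hH, hH', ← LinearMap.toMatrix'_comp, LinearEquiv.comp_symm, LinearMap.toMatrix'_id]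
  have hH'H : H' * H = 1 := by
    rw [hH, hH', ← LinearMap.toMatrix'_comp, LinearEquiv.symm_comp, LinearMap.toMatrix'_id]
  -- the intertwining identity in matrix form
  have hint : ∀ g, H * ((ψ₁ g : GL (Fin n) k) : Matrix (Fin n) (Fin n) k) =
      ((ψ₂ g : GL (Fin n) k) : Matrix (Fin n) (Fin n) k) * H := fun g ↦ by
    have h1 : (E : (Fin n → k) →ₗ[k] (Fin n → k)) ∘ₗ (ρ₁ g) =
        (ρ₂ g) ∘ₗ (E : (Fin n → k) →ₗ[k] (Fin n → k)) := e.toIntertwiningMap.isIntertwining' g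
    have h2 := congrArg LinearMap.toMatrix' h1
    rw [LinearMap.toMatrix'_comp, LinearMap.toMatrix'_comp] at h2
    rw [hρ₁, hρ₂, toMatrix'_rep_eq, toMatrix'_rep_eq] at h2
    exact h2
  refine ⟨⟨H', H, hH'H, hHH'⟩, fun g ↦ ?_⟩
  change ((ψ₁ g : GL (Fin n) k) : Matrix (Fin n) (Fin n) k) =
    H' * ((ψ₂ g : GL (Fin n) k) : Matrix (Fin n) (Fin n) k) * H
  calc ((ψ₁ g : GL (Fin n) k) : Matrix (Fin n) (Fin n) k)
      = (H' * H) * ((ψ₁ g : GL (Fin n) k) : Matrix (Fin n) (Fin n) k) := by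
        rw [hH'H, Matrix.one_mul]
    _ = H' * (H * ((ψ₁ g : GL (Fin n) k) : Matrix (Fin n) (Fin n) k)) := by
        rw [Matrix.mul_assoc]
    _ = H' * ((ψ₂ g : GL (Fin n) k) : Matrix (Fin n) (Fin n) k) * H := by
        rw [hint g, Matrix.mul_assoc]

/-- **Stub 2c (Brauer–Nesbitt assembly: block sums of irreducibles with equal characteristic polynomials are
conjugate).**  `a, d, σ, σ' : Γ → GL₂(k)` irreducible on `k²` with `det(X - a g) det(X - d g) = det(X - σ g) det(X - σ' g)`
for all `g`.  Then `a ⊕ d` and `σ ⊕ σ'` (block diagonal along `finSumFinEquiv`) are conjugate by some `h ∈ GL₄(k)`.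
Why true: both block sums are semisimple (`isSemisimpleRepresentation_of_blockDiag`; irreducible ⇒ semisimple) with
equal characteristic polynomials (`Matrix.charpoly_fromBlocks_zero₂₁`), so Brauer–Nesbitt
(`Representation.nonempty_equiv_of_charpoly_eq`, any characteristic) gives an equivalence of the representations on
`k⁴`, i.e. an intertwining invertible matrix. [cite: BourbakiAlgebreVIII2012, VIII §20 n°6 Thm 2 Cor 1] -/
theorem stub_blockSumConj :
    ∀ (k : Type) [Field k] (Γ : Type) [Group Γ] (a d σ σ' : Γ →* GL (Fin 2) k),
      Representation.IsIrreducible ((Representation.ofDistribMulAction k (GL (Fin 2) k) (Fin 2 → k)).comp a) →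
      Representation.IsIrreducible ((Representation.ofDistribMulAction k (GL (Fin 2) k) (Fin 2 → k)).comp d) →
      Representation.IsIrreducible ((Representation.ofDistribMulAction k (GL (Fin 2) k) (Fin 2 → k)).comp σ) →
      Representation.IsIrreducible ((Representation.ofDistribMulAction k (GL (Fin 2) k) (Fin 2 → k)).comp σ') →
      (∀ g, (a g).val.charpoly * (d g).val.charpoly = (σ g).val.charpoly * (σ' g).val.charpoly) →
      ∃ h : GL (Fin 4) k, ∀ g,
        Matrix.reindex finSumFinEquiv finSumFinEquiv (Matrix.fromBlocks (a g).val 0 0 (d g).val) =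
          h.val * Matrix.reindex finSumFinEquiv finSumFinEquiv (Matrix.fromBlocks (σ g).val 0 0 (σ' g).val) *
            (h⁻¹).val := by
  intro k _ Γ _ a d σ σ' ha hd hσ hσ' hcp
  -- the two block sums as homomorphisms `Γ → GL₄(k)`
  obtain ⟨ψ₁, hψ₁⟩ := exists_blockDiag_hom (k := k) (n := 4) finSumFinEquiv a d
  obtain ⟨ψ₂, hψ₂⟩ := exists_blockDiag_hom (k := k) (n := 4) finSumFinEquiv σ σ'
  -- both are semisimple on `k⁴`
  have hss₁ : Representation.IsSemisimpleRepresentation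
      ((Representation.ofDistribMulAction k (GL (Fin 4) k) (Fin 4 → k)).comp ψ₁) :=
    isSemisimpleRepresentation_of_blockDiag finSumFinEquiv hψ₁ (isSemisimple_of_isIrreducible _ ha)
      (isSemisimple_of_isIrreducible _ hd)
  have hss₂ : Representation.IsSemisimpleRepresentation
      ((Representation.ofDistribMulAction k (GL (Fin 4) k) (Fin 4 → k)).comp ψ₂) :=
    isSemisimpleRepresentation_of_blockDiag finSumFinEquiv hψ₂ (isSemisimple_of_isIrreducible _ hσ)
      (isSemisimple_of_isIrreducible _ hσ')
  -- with equal characteristic polynomials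
  have hcp' : ∀ g, ((ψ₁ g : GL (Fin 4) k) : Matrix (Fin 4) (Fin 4) k).charpoly =
      ((ψ₂ g : GL (Fin 4) k) : Matrix (Fin 4) (Fin 4) k).charpoly := fun g ↦ by
    rw [hψ₁ g, hψ₂ g, Matrix.charpoly_reindex, Matrix.charpoly_reindex,
      Matrix.charpoly_fromBlocks_zero₂₁, Matrix.charpoly_fromBlocks_zero₂₁]
    exact hcp g
  obtain ⟨h, hh⟩ := exists_conj_of_charpoly_eq ψ₁ ψ₂ hss₁ hss₂ hcp'
  refine ⟨h, fun g ↦ ?_⟩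
  rw [← hψ₁ g, ← hψ₂ g]
  exact hh g

end Summit.Langlands.Langlands.Cruxes.ResiduallyYoshidaLifting.EndoscopicCrossingEuler

end
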